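import Mathlib
import Literature.NumberTheory.LFunctions.PolynomialRootMoebiusShortInterval
import HarnessLib

/-!
# Landau's theorem for `∑ μ(n)ρ_g(n)/n` in `M`-function (sharp cut-off) form, log-power rate

Topic `Literature/NumberTheory/LFunctions` (sequel to `PolynomialRootMoebiusRieszMean.lean` and
`PolynomialRootMoebiusShortInterval.lean`). Everything here is PROVED; no definitions, no named facts.

* `abs_sum_moebius_rootCount_div_le` — for `g ∈ ℤ[X]` irreducible of positive degree there is `C`
  with `|∑_{n ≤ x} μ(n)ρ_g(n)/n| ≤ C/(log x)^2` for all real `x ≥ 2`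
  (`ρ_g(n) = #{r mod n : g(r) ≡ 0}` = `polyRootCountMod ![g] n`).

## Proof (differencing the log-Riesz mean; Montgomery–Vaughan §6.2, (6.18), and §8.4)

Write `a(n) = μ(n)ρ_g(n)`, `M(x) = ∑_{n ≤ x} a(n)/n`, `R(x) = ∑_{n ≤ x} (a(n)/n) log(x/n)`.  The tree
proves `R(x) = L + O(exp(−c√log x))`
(`Literature.NumberTheory.LFunctions.abs_logRieszMean_moebius_rootCount_sub_le`, Landau 1903 via
Perron's formula for `H(s)/ζ_K(s)`, `K = ℚ[X]/(g)`).  For `1 ≤ x ≤ y`,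
`R(y) − R(x) = log(y/x)·M(x) + ∑_{x < n ≤ y} (a(n)/n) log(y/n)` (`MoebiusRootCount.logRieszSum_sub_eq`)
and the tail is at most `(log(y/x)/x)·∑_{x<n≤y} |a(n)|` (`MoebiusRootCount.abs_tail_le`).  The
short-interval mass is `∑_{x < n ≤ y} |a(n)| ≤ A₁(y − x) + A₂ y^θ` with `θ < 1`
(`MoebiusRootCount.shortInterval_abs_moebius_mul_rootCount_le`).  Taking `y = x(1 + (log x)^{-2})`
gives `|M(x)| ≪ (log x)² e^{−c√log x} + (log x)^{-2} + x^{θ−1} ≪ (log x)^{-2}` (the same argument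
with `y = x(1 + e^{−(c/2)√log x})` would give the de la Vallée-Poussin rate; the log-power form is
what the Type-I bookkeeping of Bateman–Horn-type sums consumes).

## References

* E. Landau, *Neuer Beweis des Primzahlsatzes und Beweis des Primidealsatzes*, Math. Ann. 56 (1903),
  645–670, Part II. [LandauMathAnn1903]
* H. L. Montgomery, R. C. Vaughan, *Multiplicative Number Theory I*, CUP 2007, §6.2 (6.17)–(6.19)
  (`∑_{n≤x} μ(n)/n ≪ exp(−c√log x)`, "the method … is very flexible") and §8.4, Theorem 8.9 (Landau's
  prime ideal theorem). [MontgomeryVaughan2007]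

## Mathlib / tree search

Mathlib: `Real.log_le_rpow_div`, `Real.pow_div_factorial_le_exp`, `Real.one_sub_inv_le_log_of_pos`,
`Finset.sum_Ioc_consecutive`. Tree: `abs_logRieszMean_moebius_rootCount_sub_le` (Riesz form, dlVP
rate). No sharp-cutoff Möbius–root-count bound existed
(`lean search 'sum.*moebius.*polyRootCountMod|rootCount.*moebius'`: Riesz form only).
-/

noncomputable section

open Filter Finset Nat ArithmeticFunction Polynomial Complex
open scoped Topology BigOperators NumberField ArithmeticFunction.Moebius

namespace Literature.NumberTheory.LFunctions

open Literature.NumberTheory.Sieve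

namespace MoebiusRootCount

/-- `Icc 1 N = Ioc 0 N` in `ℕ`. [folklore] -/
theorem Icc_one_eq_Ioc_zero (N : ℕ) : (Icc 1 N : Finset ℕ) = Ioc 0 N := by
  rw [← Finset.Icc_add_one_left_eq_Ioc, zero_add]

/-- The difference identity `R(y) − R(x) = log(y/x)·M(x) + ∑_{x < n ≤ y} (a(n)/n) log(y/n)` for the
log-Riesz mean `R(x) = ∑_{n ≤ x} (a(n)/n) log(x/n)` of `M(x) = ∑_{n ≤ x} a(n)/n`. [folklore] -/
theorem logRieszSum_sub_eq (a : ℕ → ℝ) {x y : ℝ} (hx : 0 < x) (hxy : x ≤ y) :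
    (∑ n ∈ Icc 1 ⌊y⌋₊, a n / n * Real.log (y / n)) - ∑ n ∈ Icc 1 ⌊x⌋₊, a n / n * Real.log (x / n) =
      Real.log (y / x) * (∑ n ∈ Icc 1 ⌊x⌋₊, a n / n) +
        ∑ n ∈ Ioc ⌊x⌋₊ ⌊y⌋₊, a n / n * Real.log (y / n) := by
  have hy : 0 < y := hx.trans_le hxy
  have hXY : ⌊x⌋₊ ≤ ⌊y⌋₊ := Nat.floor_le_floor hxy
  rw [Icc_one_eq_Ioc_zero, Icc_one_eq_Ioc_zero,
    ← Finset.sum_Ioc_consecutive _ (Nat.zero_le _) hXY, Finset.mul_sum]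
  have h1 : ∀ n ∈ Ioc 0 ⌊x⌋₊, a n / n * Real.log (y / n) - a n / n * Real.log (x / n) =
      Real.log (y / x) * (a n / n) := by
    intro n hn
    rw [Finset.mem_Ioc] at hn
    have hn0 : (0 : ℝ) < n := by exact_mod_cast hn.1
    rw [← mul_sub, ← Real.log_div (by positivity) (by positivity),
      show y / n / (x / n) = y / x by field_simp]
    ring
  rw [← Finset.sum_congr rfl h1, Finset.sum_sub_distrib]
  ring

/-- The tail `∑_{x < n ≤ y} (a(n)/n) log(y/n)` is at most `(log(y/x)/x) ∑_{x < n ≤ y} |a(n)|`. [folklore] -/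
theorem abs_tail_le (a : ℕ → ℝ) {x y : ℝ} (hx : 0 < x) (hxy : x ≤ y) :
    |∑ n ∈ Ioc ⌊x⌋₊ ⌊y⌋₊, a n / n * Real.log (y / n)| ≤
      Real.log (y / x) / x * ∑ n ∈ Ioc ⌊x⌋₊ ⌊y⌋₊, |a n| := by
  have hy : 0 < y := hx.trans_le hxy
  rw [Finset.mul_sum]
  refine (Finset.abs_sum_le_sum_abs _ _).trans (Finset.sum_le_sum fun n hn => ?_)
  rw [Finset.mem_Ioc] at hn
  have hxn : x < n := (Nat.lt_floor_add_one x).trans_le (by exact_mod_cast hn.1)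
  have hn0 : (0 : ℝ) < n := hx.trans hxn
  have hny : (n : ℝ) ≤ y := (Nat.cast_le.mpr hn.2).trans (Nat.floor_le hy.le)
  have hlog0 : 0 ≤ Real.log (y / n) := Real.log_nonneg (by rwa [le_div_iff₀ hn0, one_mul])
  have hlog : Real.log (y / n) ≤ Real.log (y / x) :=
    Real.log_le_log (by positivity) (div_le_div_of_nonneg_left hy.le hx hxn.le)
  have hq : Real.log (y / n) / n ≤ Real.log (y / x) / x :=
    calc Real.log (y / n) / n ≤ Real.log (y / x) / n := div_le_div_of_nonneg_right hlog hn0.le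
      _ ≤ Real.log (y / x) / x := div_le_div_of_nonneg_left (hlog0.trans hlog) hx hxn.le
  rw [abs_mul, abs_div, abs_of_nonneg hlog0, abs_of_pos hn0]
  calc |a n| / n * Real.log (y / n) = |a n| * (Real.log (y / n) / n) := by ring
    _ ≤ |a n| * (Real.log (y / x) / x) := mul_le_mul_of_nonneg_left hq (abs_nonneg (a n))
    _ = Real.log (y / x) / x * |a n| := by ring

/-- `u^8 e^{-cu} ≤ 8!/c^8` for `u ≥ 0`, `c > 0`. [folklore] -/
theorem pow_eight_mul_exp_neg_le {c : ℝ} (hc : 0 < c) {u : ℝ} (hu : 0 ≤ u) :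
    u ^ 8 * Real.exp (-(c * u)) ≤ (Nat.factorial 8 : ℝ) / c ^ 8 := by
  have h := Real.pow_div_factorial_le_exp (c * u) (by positivity) 8
  rw [div_le_iff₀ (by positivity)] at h
  rw [le_div_iff₀ (by positivity), Real.exp_neg]
  have hE : 0 < Real.exp (c * u) := Real.exp_pos _
  calc u ^ 8 * (Real.exp (c * u))⁻¹ * c ^ 8 = (c * u) ^ 8 / Real.exp (c * u) := by
        rw [div_eq_mul_inv]; ring
    _ ≤ (Nat.factorial 8 : ℝ) := by
        rw [div_le_iff₀ hE]; linarith

/-- `x^{θ-1} (log x)^2 ≤ 4/(1-θ)^2` for `x ≥ 1`, `θ < 1`. [folklore] -/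
theorem rpow_mul_log_sq_le {θ : ℝ} (hθ : θ < 1) {x : ℝ} (hx : 1 ≤ x) :
    x ^ (θ - 1) * Real.log x ^ 2 ≤ 1 / ((1 - θ) / 2) ^ 2 := by
  set ε : ℝ := (1 - θ) / 2 with hε
  have hε0 : 0 < ε := by rw [hε]; linarith
  have hx0 : 0 < x := by linarith
  have hl0 : 0 ≤ Real.log x := Real.log_nonneg hx
  have h1 : Real.log x ≤ x ^ ε / ε := Real.log_le_rpow_div hx0.le hε0
  have h2 : Real.log x ^ 2 ≤ (x ^ ε / ε) ^ 2 := pow_le_pow_left₀ hl0 h1 2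
  have h3 : (x ^ ε / ε) ^ 2 = x ^ (1 - θ) / ε ^ 2 := by
    rw [div_pow, ← Real.rpow_natCast, ← Real.rpow_mul hx0.le]
    congr 2
    rw [hε]; push_cast; ring
  have h4 : x ^ (θ - 1) * x ^ (1 - θ) = 1 := by
    rw [← Real.rpow_add hx0]; simp
  calc x ^ (θ - 1) * Real.log x ^ 2 ≤ x ^ (θ - 1) * (x ^ (1 - θ) / ε ^ 2) := by
        rw [← h3]; exact mul_le_mul_of_nonneg_left h2 (by positivity)
    _ = 1 / ε ^ 2 := by rw [mul_div_assoc', h4]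

end MoebiusRootCount

/-- **Landau's prime ideal theorem for `∑ μ(n)ρ_g(n)/n` in `M`-function (sharp cut-off) form,
log-power rate.** For `g ∈ ℤ[X]` irreducible of positive degree there is `C` with
`|∑_{n ≤ x} μ(n)ρ_g(n)/n| ≤ C/(log x)^2` for all real `x ≥ 2`. (From the tree's log-Riesz form
with de la Vallée-Poussin rate by differencing over `[x, x(1 + (log x)^{-2})]`, the short-interval
mass being controlled by the Weber–Landau ideal count.) [cite: LandauMathAnn1903, Part II] -/
theorem abs_sum_moebius_rootCount_div_le {g : ℤ[X]} (hirr : Irreducible g)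
    (hdeg : 0 < g.natDegree) :
    ∃ C : ℝ, ∀ x : ℝ, 2 ≤ x →
      |∑ n ∈ Icc 1 ⌊x⌋₊, (ArithmeticFunction.moebius n : ℝ) * (polyRootCountMod ![g] n : ℝ) / n| ≤
        C / Real.log x ^ 2 := by
  obtain ⟨L, c, hc, C, hR⟩ := abs_logRieszMean_moebius_rootCount_sub_le hirr hdeg
  obtain ⟨A₁, A₂, θ, hA₁, hA₂, hθ1, hS⟩ :=
    MoebiusRootCount.shortInterval_abs_moebius_mul_rootCount_le hirr hdeg
  have hC0 : 0 ≤ C := by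
    have h := (abs_nonneg _).trans (hR 1 le_rfl)
    rw [Real.log_one, Real.sqrt_zero, mul_zero, Real.exp_zero, mul_one] at h
    exact h
  set h₀ : ℝ := 1 / Real.log 2 ^ 2 with hh₀
  set K₈ : ℝ := (Nat.factorial 8 : ℝ) / c ^ 8 with hK₈
  set Bθ : ℝ := 1 / ((1 - θ) / 2) ^ 2 with hBθ
  have hlog2 : 0 < Real.log 2 := Real.log_pos (by norm_num)
  have hh₀0 : 0 < h₀ := by positivity
  refine ⟨2 * C * (1 + h₀) * K₈ + A₁ + A₂ * (1 + h₀) * Bθ, fun x hx => ?_⟩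
  -- the parameters
  set a : ℕ → ℝ := fun n => (ArithmeticFunction.moebius n : ℝ) * (polyRootCountMod ![g] n : ℝ)
    with ha
  set lx : ℝ := Real.log x with hlx
  have hx0 : 0 < x := by linarith
  have hx1 : 1 ≤ x := by linarith
  have hlx2 : Real.log 2 ≤ lx := Real.log_le_log (by norm_num) hx
  have hlx0 : 0 < lx := hlog2.trans_le hlx2
  set h : ℝ := 1 / lx ^ 2 with hh
  have hh0 : 0 < h := by positivity
  have hhle : h ≤ h₀ := by
    rw [hh, hh₀]
    exact div_le_div_of_nonneg_left zero_le_one (by positivity) (pow_le_pow_left₀ hlog2.le hlx2 2)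
  have hhlx : h * lx ^ 2 = 1 := by rw [hh]; field_simp
  set y : ℝ := x * (1 + h) with hy
  have hxy : x ≤ y := by rw [hy]; nlinarith
  have hy0 : 0 < y := hx0.trans_le hxy
  have hyx : y / x = 1 + h := by rw [hy]; field_simp
  set ℓ : ℝ := Real.log (y / x) with hℓ
  have hℓlow : h / (1 + h) ≤ ℓ := by
    rw [hℓ, hyx]
    have := Real.one_sub_inv_le_log_of_pos (by positivity : (0 : ℝ) < 1 + h)
    rwa [show 1 - (1 + h)⁻¹ = h / (1 + h) by field_simp; ring] at this
  have hℓ0 : 0 < ℓ := lt_of_lt_of_le (by positivity) hℓlow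
  -- the three analytic inputs at `x` and `y`
  set E : ℝ := Real.exp (-(c * Real.sqrt lx)) with hE
  have hRx : |(∑ n ∈ Icc 1 ⌊x⌋₊, a n / n * Real.log (x / n)) - L| ≤ C * E := by
    have := hR x hx1
    rw [neg_mul] at this
    exact this
  have hRy : |(∑ n ∈ Icc 1 ⌊y⌋₊, a n / n * Real.log (y / n)) - L| ≤ C * E := by
    refine (hR y (hx1.trans hxy)).trans ?_
    rw [hE, neg_mul]
    refine mul_le_mul_of_nonneg_left (Real.exp_le_exp.mpr ?_) hC0
    exact neg_le_neg (mul_le_mul_of_nonneg_left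
      (Real.sqrt_le_sqrt (Real.log_le_log hx0 hxy)) hc.le)
  have hT : |∑ n ∈ Ioc ⌊x⌋₊ ⌊y⌋₊, a n / n * Real.log (y / n)| ≤
      ℓ / x * (A₁ * (y - x) + A₂ * y ^ θ) :=
    (MoebiusRootCount.abs_tail_le a hx0 hxy).trans
      (mul_le_mul_of_nonneg_left (hS x y hx1 hxy) (by positivity))
  have hid := MoebiusRootCount.logRieszSum_sub_eq a hx0 hxy
  -- `ℓ |M| ≤ 2 C E + (ℓ/x)(A₁ (y-x) + A₂ y^θ)`
  set M : ℝ := ∑ n ∈ Icc 1 ⌊x⌋₊, a n / n with hM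
  have hmain : ℓ * |M| ≤ 2 * (C * E) + ℓ / x * (A₁ * (y - x) + A₂ * y ^ θ) := by
    have e : ℓ * M = ((∑ n ∈ Icc 1 ⌊y⌋₊, a n / n * Real.log (y / n)) - L) -
        ((∑ n ∈ Icc 1 ⌊x⌋₊, a n / n * Real.log (x / n)) - L) -
        ∑ n ∈ Ioc ⌊x⌋₊ ⌊y⌋₊, a n / n * Real.log (y / n) := by
      rw [hM]; linarith
    have habs : ℓ * |M| = |((∑ n ∈ Icc 1 ⌊y⌋₊, a n / n * Real.log (y / n)) - L) -
        ((∑ n ∈ Icc 1 ⌊x⌋₊, a n / n * Real.log (x / n)) - L) -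
        ∑ n ∈ Ioc ⌊x⌋₊ ⌊y⌋₊, a n / n * Real.log (y / n)| := by
      rw [← e, abs_mul, abs_of_pos hℓ0]
    have h1 := abs_sub (((∑ n ∈ Icc 1 ⌊y⌋₊, a n / n * Real.log (y / n)) - L) -
        ((∑ n ∈ Icc 1 ⌊x⌋₊, a n / n * Real.log (x / n)) - L))
        (∑ n ∈ Ioc ⌊x⌋₊ ⌊y⌋₊, a n / n * Real.log (y / n))
    have h2 := abs_sub ((∑ n ∈ Icc 1 ⌊y⌋₊, a n / n * Real.log (y / n)) - L)
        ((∑ n ∈ Icc 1 ⌊x⌋₊, a n / n * Real.log (x / n)) - L)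
    rw [habs]
    linarith
  -- divide by `ℓ`
  have hM1 : |M| ≤ 2 * (C * E) / ℓ + (A₁ * h + A₂ * (y ^ θ / x)) := by
    have e2 : ℓ / x * (A₁ * (y - x) + A₂ * y ^ θ) = ℓ * (A₁ * h + A₂ * (y ^ θ / x)) := by
      rw [hy]; field_simp; ring
    rw [e2] at hmain
    have : |M| ≤ (2 * (C * E) + ℓ * (A₁ * h + A₂ * (y ^ θ / x))) / ℓ := by
      rw [le_div_iff₀ hℓ0]; linarith
    rwa [add_div, mul_div_cancel_left₀ _ hℓ0.ne'] at this
  -- the exponential term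
  have hElx : E * lx ^ 4 ≤ K₈ := by
    have hu := MoebiusRootCount.pow_eight_mul_exp_neg_le hc (Real.sqrt_nonneg lx)
    have h8 : Real.sqrt lx ^ 8 = lx ^ 4 := by
      rw [show (8 : ℕ) = 2 * 4 from rfl, pow_mul, Real.sq_sqrt hlx0.le]
    rw [h8, mul_comm] at hu
    exact hu
  have hb1 : 2 * (C * E) / ℓ * lx ^ 2 ≤ 2 * C * (1 + h₀) * K₈ := by
    have step1 : 2 * (C * E) / ℓ ≤ 2 * (C * E) / (h / (1 + h)) :=
      div_le_div_of_nonneg_left (by positivity) (by positivity) hℓlow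
    have step2 : 2 * (C * E) / (h / (1 + h)) * lx ^ 2 = 2 * C * (1 + h) * (E * lx ^ 4) := by
      rw [hh]; field_simp
    calc 2 * (C * E) / ℓ * lx ^ 2 ≤ 2 * (C * E) / (h / (1 + h)) * lx ^ 2 :=
          mul_le_mul_of_nonneg_right step1 (by positivity)
      _ = 2 * C * (1 + h) * (E * lx ^ 4) := step2
      _ ≤ 2 * C * (1 + h₀) * K₈ :=
          mul_le_mul (mul_le_mul_of_nonneg_left (by linarith) (by positivity)) hElx
            (by positivity) (by positivity)
  -- the power-saving term
  have hb3 : A₂ * (y ^ θ / x) * lx ^ 2 ≤ A₂ * (1 + h₀) * Bθ := by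
    have hyθ : y ^ θ / x = (1 + h) ^ θ * x ^ (θ - 1) := by
      rw [hy, Real.mul_rpow hx0.le (by positivity), Real.rpow_sub_one hx0.ne']; ring
    have h1h : (1 + h) ^ θ ≤ 1 + h := by
      have := Real.rpow_le_rpow_of_exponent_le (by linarith : (1 : ℝ) ≤ 1 + h) hθ1.le
      rwa [Real.rpow_one] at this
    have hxθ : x ^ (θ - 1) * lx ^ 2 ≤ Bθ := MoebiusRootCount.rpow_mul_log_sq_le hθ1 hx1
    have hBθ0 : 0 ≤ Bθ := by rw [hBθ]; positivity
    calc A₂ * (y ^ θ / x) * lx ^ 2 = A₂ * ((1 + h) ^ θ * (x ^ (θ - 1) * lx ^ 2)) := by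
          rw [hyθ]; ring
      _ ≤ A₂ * ((1 + h₀) * Bθ) := by
          refine mul_le_mul_of_nonneg_left ?_ hA₂
          exact mul_le_mul (h1h.trans (by linarith)) hxθ (by positivity) (by positivity)
      _ = A₂ * (1 + h₀) * Bθ := by ring
  -- conclusion
  rw [le_div_iff₀ (by positivity : (0 : ℝ) < lx ^ 2)]
  calc |M| * lx ^ 2 ≤ (2 * (C * E) / ℓ + (A₁ * h + A₂ * (y ^ θ / x))) * lx ^ 2 :=
        mul_le_mul_of_nonneg_right hM1 (by positivity)
    _ = 2 * (C * E) / ℓ * lx ^ 2 + A₁ * (h * lx ^ 2) + A₂ * (y ^ θ / x) * lx ^ 2 := by ring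
    _ ≤ 2 * C * (1 + h₀) * K₈ + A₁ * 1 + A₂ * (1 + h₀) * Bθ := by rw [hhlx]; linarith
    _ = 2 * C * (1 + h₀) * K₈ + A₁ + A₂ * (1 + h₀) * Bθ := by ring

end Literature.NumberTheory.LFunctions
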